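import Summits.MatrixMultiplication.MatrixMultiplication.Theorems.ObstructionDescentPairLaw
import Summits.MatrixMultiplication.MatrixMultiplication.Theorems.ObstructionDescentLevelMonoid

set_option linter.dupNamespace false

/-!
# Obstruction descent, part L — empty levels do not depend on the ambient format; H19 with its input at format 2

`route-MatrixMultiplication-ObstructionDescent`, aside `InvariantSaturation` (stmt 32282); decomp-mm lens-3, NODE-g15.

The invariant tower states its Kronecker inputs as `k ∈ emptyLevels m N` («no weight vector of the corner type `((k^N))³`
in degree `kN` on the format `m`»), an a-priori FORMAT-DEPENDENT hypothesis.  This file proves the descent complementing the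
landed format-raising map `liftPoly` (`ObstructionDescentLevelMonoid` §1, H11a):

* **Descent (`exists_eq_liftPoly_of_mem_hwvSpace`).**  Every weight vector of the corner type `((k^N))³` on the format
  `d + m` (`N ≤ m`) IS the lift `liftPoly d f` of a weight vector `f` of type `((k^N))³` on the format `m`: its variables
  lie in the top corner (indices of positive weight, `le_weight_of_mem_support`), so it is a renaming (Mathlib
  `exists_rename_eq_of_vars_subset_range`), and the Borel group of `GL_m` embedded as lower-right blocks
  (`exists_borel_blk_eq`) transports the semi-invariance down (`cornerOf_actTensor`, `weightChar_liftType`).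
* **Format independence of emptiness (`emptyLevels_add_eq`, `emptyLevels_eq_of_le`).**  Hence
  `emptyLevels m' N = emptyLevels m N` for `N ≤ m ≤ m'`: the vanishing of a Kronecker-type multiplicity `k_N(k) = 0` is
  ONE statement, readable at the smallest format `m = N`.
* **H19 with a fixed finite input (`evalT_eq_zero_of_emptyLevel_two_two`, `…_level_three'`).**  The pair law of part K
  therefore needs only `k ∈ emptyLevels 2 2` — for level `3` the single statement `3 ∈ emptyLevels 2 2` about
  homogeneous sextics in the `8` coordinates of `ℂ² ⊗ ℂ² ⊗ ℂ²` (`= g((3,3),(3,3),(3,3)) = 0`; classically: the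
  `SL₂³`-invariants of `ℂ²⊗ℂ²⊗ℂ²` are `ℂ[Δ]`, `deg Δ = 4`) — to give, at EVERY format `m ≥ 2`, the vanishing of all
  level-`3` vectors on `σ_r`, `2r + 1 < 3m`.

[cite: BurgisserIkenmeyer2017, §5 (5.2), Thm 5.3] (exponent monoids; format monotonicity), [cite: BurgisserIkenmeyer2011,
§3.1–3.2 and §6.2] (weight vectors; Strassen's invariant), [cite: LandsbergGCT2017, §8.3.4].
-/

noncomputable section

open scoped BigOperators
open Finset

namespace Summit.MatrixMultiplication.MatrixMultiplication.Theorems.ObstructionCalculus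

open Literature.Computability.AlgebraicComplexity (actTensor actTensor_apply tensorRank)

section EmptyLevelFormat

variable {m d : ℕ}

/-- **Block embedding of the Borel group.**  Every upper-triangular invertible `m × m` matrix is the lower-right block of an
upper-triangular invertible `(d+m) × (d+m)` matrix (namely `1 ⊕ P`). [bookkeeping] -/
theorem exists_borel_blk_eq (d : ℕ) {P : Matrix (Fin m) (Fin m) ℂ} (hP : P ∈ borel m) :
    ∃ P' : Matrix (Fin (d + m)) (Fin (d + m)) ℂ, P' ∈ borel (d + m) ∧ blk d P' = P := by
  classical
  refine ⟨fun i j => if hi : d ≤ (i : ℕ) then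
      (if hj : d ≤ (j : ℕ) then P ⟨i - d, by omega⟩ ⟨j - d, by omega⟩ else 0)
    else (if i = j then 1 else 0), ⟨?_, ?_⟩, ?_⟩
  · intro i j hji
    rw [Fin.lt_def] at hji
    by_cases hi : d ≤ (i : ℕ)
    · by_cases hj : d ≤ (j : ℕ)
      · simp only [hi, hj, dif_pos]
        exact hP.1 _ _ (by rw [Fin.lt_def]; simp only; omega)
      · simp only [hi, hj, dif_pos, dif_neg, not_false_eq_true]
    · have hij : i ≠ j := fun h => by rw [h] at hji; exact lt_irrefl _ hji
      simp only [hi, dif_neg, not_false_eq_true, if_neg hij]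
  · intro i
    by_cases hi : d ≤ (i : ℕ)
    · simp only [hi, dif_pos]
      exact hP.2 _
    · simp only [hi, dif_neg, not_false_eq_true]
      exact one_ne_zero
  · funext a b
    simp only [blk, Fin.natAdd, Nat.le_add_right, dif_pos]
    congr 1 <;> exact Fin.ext (by simp)

/-- `liftI` is injective. [bookkeeping] -/
theorem liftI_injective (d : ℕ) : Function.Injective (liftI (m := m) d) := by
  intro p q h
  simp only [liftI, Prod.mk.injEq, Fin.natAdd_inj] at h
  exact Prod.ext h.1 (Prod.ext h.2.1 h.2.2)

/-- **Exponents are bounded by weights.**  In a monomial of a weight vector of type `Λ`, the exponent of `x_{(a,b,c)}` is at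
most each of the three weights `Λ₀ a`, `Λ₁ b`, `Λ₂ c` (slice sums). [bookkeeping] -/
theorem le_weight_of_mem_support {Λ : Fin 3 → Fin m → ℕ} {e : ℕ} {f : MvPolynomial (Idx m) ℂ} (hf : f ∈ hwvSpace Λ e)
    {μ : Idx m →₀ ℕ} (hμ : μ ∈ f.support) {p : Idx m} (hp : p ∈ μ.support) :
    μ p ≤ Λ 0 p.1 ∧ μ p ≤ Λ 1 p.2.1 ∧ μ p ≤ Λ 2 p.2.2 := by
  classical
  obtain ⟨h0, -, -⟩ := sliceSum_eq_of_mem_support hf hμ p.1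
  obtain ⟨-, h1, -⟩ := sliceSum_eq_of_mem_support hf hμ p.2.1
  obtain ⟨-, -, h2⟩ := sliceSum_eq_of_mem_support hf hμ p.2.2
  refine ⟨?_, ?_, ?_⟩
  · rw [← h0]
    exact Finset.single_le_sum (f := fun q => μ q) (fun _ _ => Nat.zero_le _) (Finset.mem_filter.mpr ⟨hp, rfl⟩)
  · rw [← h1]
    exact Finset.single_le_sum (f := fun q => μ q) (fun _ _ => Nat.zero_le _) (Finset.mem_filter.mpr ⟨hp, rfl⟩)
  · rw [← h2]
    exact Finset.single_le_sum (f := fun q => μ q) (fun _ _ => Nat.zero_le _) (Finset.mem_filter.mpr ⟨hp, rfl⟩)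

/-- **Descent of corner-type weight vectors.**  A weight vector of the corner type `((k^N))³`, degree `kN`, on the format
`d + m` (`N ≤ m`) is the lift of a weight vector of type `((k^N))³`, degree `kN`, on the format `m`. [this node] -/
theorem exists_eq_liftPoly_of_mem_hwvSpace {N k : ℕ} (hN : N ≤ m) {F : MvPolynomial (Idx (d + m)) ℂ}
    (hF : F ∈ hwvSpace (rectType (d + m) N k) (k * N)) :
    ∃ f : MvPolynomial (Idx m) ℂ, f ∈ hwvSpace (rectType m N k) (k * N) ∧ liftPoly d f = F := by
  classical
  -- (1) the variables of `F` lie in the top corner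
  have hcorner : ∀ (s : Fin 3) (i : Fin (d + m)) (n : ℕ), n ≠ 0 → n ≤ rectType (d + m) N k s i → d ≤ (i : ℕ) := by
    intro s i n hn h
    by_contra hlt
    simp only [rectType] at h
    rw [if_neg (by omega)] at h
    omega
  have hvars : (↑F.vars : Set (Idx (d + m))) ⊆ Set.range (liftI (m := m) d) := by
    intro q hq
    rw [Finset.mem_coe, MvPolynomial.mem_vars_iff_mem_support] at hq
    obtain ⟨μ, hμ, hqμ⟩ := hq
    have hq0 : μ q ≠ 0 := Finsupp.mem_support_iff.mp hqμ
    obtain ⟨h0, h1, h2⟩ := le_weight_of_mem_support hF hμ hqμ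
    have hd0 := hcorner 0 q.1 _ hq0 h0
    have hd1 := hcorner 1 q.2.1 _ hq0 h1
    have hd2 := hcorner 2 q.2.2 _ hq0 h2
    have hl0 := q.1.isLt
    have hl1 := q.2.1.isLt
    have hl2 := q.2.2.isLt
    refine ⟨(⟨(q.1 : ℕ) - d, by omega⟩, ⟨(q.2.1 : ℕ) - d, by omega⟩, ⟨(q.2.2 : ℕ) - d, by omega⟩), ?_⟩
    simp only [liftI]
    refine Prod.ext (Fin.ext ?_) (Prod.ext (Fin.ext ?_) (Fin.ext ?_)) <;> simp only [Fin.natAdd] <;> omega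
  -- (2) so `F` is a renaming along `liftI`
  obtain ⟨f, hfF⟩ := MvPolynomial.exists_rename_eq_of_vars_subset_range F (liftI d) (liftI_injective d) hvars
  have hlift : liftPoly d f = F := hfF
  refine ⟨f, ⟨?_, fun P Q R hP hQ hR t => ?_⟩, hlift⟩
  -- (3) homogeneity descends along an injective renaming
  · have h := hF.1
    rw [← hfF] at h
    exact (MvPolynomial.IsHomogeneous.rename_isHomogeneous_iff (liftI_injective d)).mp h
  -- (4) semi-invariance descends along the block embedding of the Borel group
  · obtain ⟨P', hP', hPb⟩ := exists_borel_blk_eq d hP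
    obtain ⟨Q', hQ', hQb⟩ := exists_borel_blk_eq d hQ
    obtain ⟨R', hR', hRb⟩ := exists_borel_blk_eq d hR
    have key := hF.2 P' Q' R' hP' hQ' hR' (padTensor (Fin.natAdd d) t)
    rw [← hlift, evalT_liftPoly, evalT_liftPoly, cornerOf_actTensor hP' hQ' hR', cornerOf_padTensor, hPb, hQb, hRb,
      ← liftType_rectType hN k, weightChar_liftType, weightChar_liftType, weightChar_liftType, hPb, hQb, hRb] at key
    exact key

/-- **Emptiness ascends in the format.** `emptyLevels m N ⊆ emptyLevels (d + m) N` for `N ≤ m`. [this node] -/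
theorem emptyLevels_subset_emptyLevels_add {N : ℕ} (hN : N ≤ m) (d : ℕ) : emptyLevels m N ⊆ emptyLevels (d + m) N := by
  intro k hk
  have hbot : hwvSpace (rectType m N k) (k * N) = ⊥ := hk
  show hwvSpace (rectType (d + m) N k) (k * N) = ⊥
  rw [Submodule.eq_bot_iff]
  intro F hF
  obtain ⟨f, hf, rfl⟩ := exists_eq_liftPoly_of_mem_hwvSpace hN hF
  rw [hbot, Submodule.mem_bot] at hf
  rw [hf, liftPoly, map_zero]

/-- **… and descends** (the landed format-raising map): `emptyLevels (d + m) N ⊆ emptyLevels m N` for `N ≤ m`. [this node] -/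
theorem emptyLevels_add_subset_emptyLevels {N : ℕ} (hN : N ≤ m) (d : ℕ) : emptyLevels (d + m) N ⊆ emptyLevels m N := by
  intro k hk
  have hbot : hwvSpace (rectType (d + m) N k) (k * N) = ⊥ := hk
  show hwvSpace (rectType m N k) (k * N) = ⊥
  rw [Submodule.eq_bot_iff]
  intro f hf
  have h := liftPoly_mem_hwvSpace (d := d) hf
  rw [liftType_rectType hN, hbot, Submodule.mem_bot] at h
  exact MvPolynomial.rename_injective _ (liftI_injective d) (by rw [map_zero]; exact h)

/-- **Format independence of empty levels:** `emptyLevels (d + m) N = emptyLevels m N` (`N ≤ m`). [this node] -/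
theorem emptyLevels_add_eq {N : ℕ} (hN : N ≤ m) (d : ℕ) : emptyLevels (d + m) N = emptyLevels m N :=
  Set.Subset.antisymm (emptyLevels_add_subset_emptyLevels hN d) (emptyLevels_subset_emptyLevels_add hN d)

/-- **Format independence of empty levels:** `emptyLevels m' N = emptyLevels m N` for `N ≤ m ≤ m'` — whether a level is
empty (`k_N(k) = 0` in the census notation) is one statement, readable at the smallest format. [this node] -/
theorem emptyLevels_eq_of_le {N m' : ℕ} (hN : N ≤ m) (h : m ≤ m') : emptyLevels m' N = emptyLevels m N := by
  obtain ⟨d, rfl⟩ := Nat.exists_eq_add_of_le' h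
  exact emptyLevels_add_eq hN d

/-- In particular the emptiness of a level at corner format `N` may be read at the format `N` itself. [this node] -/
theorem mem_emptyLevels_iff_self {N k : ℕ} (hN : N ≤ m) : k ∈ emptyLevels m N ↔ k ∈ emptyLevels N N := by
  rw [emptyLevels_eq_of_le le_rfl hN]

end EmptyLevelFormat

/-! ### H19 with its single input at format 2 -/

section PairLawFormatTwo

variable {m : ℕ}

/-- **THE PAIR LAW with a fixed finite input.**  If level `k` is empty at format `2` (`k ∈ emptyLevels 2 2`, a statement
about polynomials in the `8` coordinates of `ℂ²⊗ℂ²⊗ℂ²`), then at EVERY format `m ≥ 2` all level-`k` vectors vanish on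
the tensors of rank `≤ r`, `(k−1)(r−1) < k(m−1)`. [this node] -/
theorem evalT_eq_zero_of_emptyLevel_two_two {k : ℕ} (hk : k ∈ emptyLevels 2 2) (hm : 2 ≤ m)
    {f : MvPolynomial (Idx m) ℂ} (hf : f ∈ hwvSpace (rectType m m k) (k * m)) {r : ℕ}
    (hr : (k - 1) * (r - 1) < k * (m - 1)) {t : Tensor ℂ m} (ht : tensorRank t ≤ r) : evalT t f = 0 :=
  evalT_eq_zero_of_emptyLevel_two ((mem_emptyLevels_iff_self hm).mpr hk) hf hr ht

/-- The same in level language. [this node] -/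
theorem not_mem_pointLevels_of_emptyLevel_two_two {k : ℕ} (hk : k ∈ emptyLevels 2 2) (hm : 2 ≤ m) {r : ℕ}
    (hr : (k - 1) * (r - 1) < k * (m - 1)) {t : Tensor ℂ m} (ht : tensorRank t ≤ r) : k ∉ pointLevels m t :=
  not_mem_pointLevels_of_emptyLevel_two ((mem_emptyLevels_iff_self hm).mpr hk) hr ht

/-- **H19 at level 3, final kernel form.**  `3 ∈ emptyLevels 2 2` (`g((3,3),(3,3),(3,3)) = 0`) implies, at every format
`m ≥ 2`, that all level-`3` vectors vanish on `σ_r` for `2r + 1 < 3m` — `r_m(3) ≥ ⌈(3m−1)/2⌉`: `r₄(3) ≥ 6`, `r₆(3) ≥ 9`,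
`r₈(3) ≥ 12`, `r₉(3) ≥ 13`. [this node] [cite: BurgisserIkenmeyer2011, §6.2] -/
theorem evalT_eq_zero_of_emptyLevel_two_two_level_three (hk : 3 ∈ emptyLevels 2 2) (hm : 2 ≤ m)
    {f : MvPolynomial (Idx m) ℂ} (hf : f ∈ hwvSpace (rectType m m 3) (3 * m)) {r : ℕ} (hr : 2 * r + 1 < 3 * m)
    {t : Tensor ℂ m} (ht : tensorRank t ≤ r) : evalT t f = 0 :=
  evalT_eq_zero_of_emptyLevel_two_level_three ((mem_emptyLevels_iff_self hm).mpr hk) hf hm hr ht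

end PairLawFormatTwo

end Summit.MatrixMultiplication.MatrixMultiplication.Theorems.ObstructionCalculus

end
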